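import Summits.HubbardSuperconductivity.HubbardSuperconductivity.Theorems.AnisotropyChordThermalChordEndpoints
import Summits.HubbardSuperconductivity.HubbardSuperconductivity.Theorems.AnisotropyChordChordXYTangentBound
import Literature.MathematicalPhysics.QuantumLattice.LiebMattisLadder
import Literature.MathematicalPhysics.QuantumLattice.LiebMattisMatrixElements

/-!
# Route `AnisotropyChord`, crux `ChordXY` (stmt-HubbardSuperconductivity-8146), line `condensate-slab`:
# the POLARISED BOUNDARY VECTOR `P₀𝟙` of the slab — it is the half-filled indicator, and it is the
# Perron (top) eigenvector of the condensate operator `S⁺_tot S⁻_tot` on the half-filled sector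

Notation: spin-½ `M × M` torus, configurations `σ : TorusSite 2 M → Fin 2` (`σ_x = 1` = down spin),
weight `|σ| = Σ_x σ_x`, `K = spinZSector 1 0` (for even `M`: the span of the configurations of weight
`M²/2`), `P₀ = sectorProj M`, `𝟙 = fun _ => 1`, `A = condensateOp M = S⁺_tot S⁻_tot`,
`𝟙_W` the indicator of the weight-`W` configurations.

* `lowerTot_mulVec_apply`, `raiseTot_mulVec_apply` — `(S⁻_tot f)(σ) = Σ_{x : σ_x = 1} f(σ[x ↦ 0])`,
  `(S⁺_tot f)(σ) = Σ_{x : σ_x = 0} f(σ[x ↦ 1])` (spin ½);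
* `lowerTot_mulVec_weightInd`, `raiseTot_mulVec_weightInd` — `S⁻_tot 𝟙_W = (W+1)·𝟙_{W+1}`,
  `S⁺_tot 𝟙_{W+1} = (N − W)·𝟙_W` (`N = M²` sites); hence
* `condensateOp_mulVec_halfInd` — `A 𝟙_{M²/2} = (M²/2)(M²/2 + 1) · 𝟙_{M²/2}` for even `M`
  (the value `S(S+1)`, `S = M²/2`, of `S⁺S⁻` on the `S^z = 0` member of the top multiplet);
* `sectorProj_mulVec_ones` — `P₀ 𝟙 = 𝟙_{M²/2}` (even `M`), `sectorProj_mulVec_ones_ne_zero`;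
* `re_form_condensateOp_le` — the Perron bound `Re⟨x, A x⟩ ≤ (M²/2)(M²/2+1)·⟨x, x⟩` for every `x`
  supported on the half-filled configurations — an instance of the landed AM–GM tangent bound
  `re_star_dotProduct_mulVec_le_sum_norm_sq_mul_field` at the positive eigenvector `𝟙_{M²/2}`.

These are the algebraic inputs of the small-`β` expansion of the slab condensate
(`stub_slabConcave_smallBeta`).  Sources: H. Tasaki, *Physics and Mathematics of Quantum Many-Body
Systems* (2020) §2.2 (eqs. (2.1.6), (2.2.5)), §2.4–2.5, App. A.2.  Folklore; no definition is
introduced; sorry-free.  HONEST: bookkeeping for a rung stub; nothing here proves `ChordXY`;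
superconductivity in the Hubbard model is not advanced.
-/

set_option linter.dupNamespace false

noncomputable section

namespace Summit.HubbardSuperconductivity.HubbardSuperconductivity.Theorems.AnisotropyChord

open Matrix Complex Finset
open scoped ComplexOrder
open Literature.MathematicalPhysics.QuantumLattice Literature.Probability.LatticeModels

section Ladder

variable {V : Type*} [Fintype V] [DecidableEq V]

/-- **Action of `S⁻_tot` on a spin-½ amplitude**: `(S⁻_tot f)(σ) = Σ_{x : σ_x = 1} f(σ[x ↦ 0])`
(the amplitude at a configuration with `x` down is fed by the configuration with `x` up).
Tasaki (2020) §2.2. [folklore] -/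
theorem lowerTot_mulVec_apply (f : (V → Fin 2) → ℂ) (σ : V → Fin 2) :
    ((∑ y : V, onSite y (spinLower 1)) *ᵥ f) σ =
      ∑ y : V, if σ y = 1 then f (Function.update σ y 0) else 0 := by
  have hlow : ∀ k l : Fin 2, spinLower 1 k l = if k = 1 ∧ l = 0 then 1 else 0 := by
    intro k l
    rw [spinLower_eq_conjTranspose, conjTranspose_apply, spinRaise_apply]
    fin_cases k <;> fin_cases l <;> simp
  rw [Matrix.sum_mulVec, Finset.sum_apply]
  refine Finset.sum_congr rfl fun y _ => ?_
  rw [LiebMattis.onSite_mulVec_apply, Fin.sum_univ_two, hlow, hlow]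
  by_cases h : σ y = 1
  · simp [h]
  · simp [h]

/-- **Action of `S⁺_tot` on a spin-½ amplitude**: `(S⁺_tot f)(σ) = Σ_{x : σ_x = 0} f(σ[x ↦ 1])`.
Tasaki (2020) §2.2. [folklore] -/
theorem raiseTot_mulVec_apply (f : (V → Fin 2) → ℂ) (σ : V → Fin 2) :
    ((∑ x : V, onSite x (spinRaise 1)) *ᵥ f) σ =
      ∑ x : V, if σ x = 0 then f (Function.update σ x 1) else 0 := by
  have hup : ∀ k l : Fin 2, spinRaise 1 k l = if k = 0 ∧ l = 1 then 1 else 0 := by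
    intro k l
    rw [spinRaise_apply]
    fin_cases k <;> fin_cases l <;> simp
  rw [Matrix.sum_mulVec, Finset.sum_apply]
  refine Finset.sum_congr rfl fun x _ => ?_
  rw [LiebMattis.onSite_mulVec_apply, Fin.sum_univ_two, hup, hup]
  by_cases h : σ x = 0
  · simp [h]
  · simp [h]

/-- Weight bookkeeping: `|σ[x ↦ l]| + σ_x = |σ| + l`. [folklore] -/
theorem weight_update (σ : V → Fin 2) (x : V) (l : Fin 2) :
    (∑ z, ((Function.update σ x l z : Fin 2) : ℕ)) + (σ x : ℕ) = (∑ z, (σ z : ℕ)) + (l : ℕ) := by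
  have h1 : (∑ z, ((Function.update σ x l z : Fin 2) : ℕ)) =
      ∑ z, Function.update (fun z => ((σ z : Fin 2) : ℕ)) x (l : ℕ) z := by
    refine Finset.sum_congr rfl fun z _ => ?_
    rw [Function.apply_update (fun _ (t : Fin 2) => (t : ℕ)) σ x l z]
  rw [h1, Finset.sum_update_of_mem (Finset.mem_univ x), ← Finset.add_sum_erase _ _ (Finset.mem_univ x)]
  rw [Finset.sdiff_singleton_eq_erase]
  ring

omit [DecidableEq V] in
/-- The number of down spins is the weight. [folklore] -/
theorem card_filter_eq_one_eq_weight (σ : V → Fin 2) :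
    ((Finset.univ.filter fun x => σ x = 1).card : ℕ) = ∑ z, (σ z : ℕ) := by
  rw [Finset.card_filter]
  refine Finset.sum_congr rfl fun z _ => ?_
  have h : σ z = 0 ∨ σ z = 1 := by
    rcases Fin.eq_zero_or_eq_succ (σ z) with h | ⟨j, hj⟩
    · exact Or.inl h
    · right; rw [hj]; exact congrArg Fin.succ (Fin.eq_zero j)
  rcases h with h | h <;> simp [h]

omit [DecidableEq V] in
/-- The number of up spins is `N − |σ|`. [folklore] -/
theorem card_filter_eq_zero_eq (σ : V → Fin 2) :
    ((Finset.univ.filter fun x => σ x = 0).card : ℕ) + ∑ z, (σ z : ℕ) = Fintype.card V := by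
  rw [← card_filter_eq_one_eq_weight]
  have h := Finset.card_filter_add_card_filter_not (s := (Finset.univ : Finset V))
    (fun x => σ x = 0)
  have h2 : (Finset.univ.filter fun x => ¬σ x = 0) = Finset.univ.filter fun x => σ x = 1 := by
    refine Finset.filter_congr fun x _ => ?_
    constructor
    · intro hx
      rcases Fin.eq_zero_or_eq_succ (σ x) with h | ⟨j, hj⟩
      · exact absurd h hx
      · rw [hj]; exact congrArg Fin.succ (Fin.eq_zero j)
    · intro hx; rw [hx]; exact Fin.zero_lt_one.ne'
  rw [h2, Finset.card_univ] at h
  exact h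

/-- **`S⁻_tot 𝟙_W = (W+1) · 𝟙_{W+1}`** (a configuration of weight `W+1` has `W+1` down spins, each
of which can be raised to reach weight `W`). Tasaki (2020) §2.4. [folklore] -/
theorem lowerTot_mulVec_weightInd (W : ℕ) (σ : V → Fin 2) :
    ((∑ y : V, onSite y (spinLower 1)) *ᵥ
        (fun τ : V → Fin 2 => if (∑ z, (τ z : ℕ)) = W then (1 : ℂ) else 0)) σ =
      if (∑ z, (σ z : ℕ)) = W + 1 then ((W : ℂ) + 1) else 0 := by
  rw [lowerTot_mulVec_apply]
  by_cases hσ : (∑ z, (σ z : ℕ)) = W + 1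
  · rw [if_pos hσ]
    have hterm : ∀ y : V, (if σ y = 1 then
        (fun τ : V → Fin 2 => if (∑ z, (τ z : ℕ)) = W then (1 : ℂ) else 0) (Function.update σ y 0)
        else 0) = if σ y = 1 then (1 : ℂ) else 0 := by
      intro y
      by_cases hy : σ y = 1
      · have hw := weight_update σ y 0
        rw [hy, hσ] at hw
        simp only [Fin.val_one, Fin.val_zero, add_zero] at hw
        have hw' : (∑ z, ((Function.update σ y 0 z : Fin 2) : ℕ)) = W := by omega
        simp [hy, hw']
      · simp [hy]
    rw [Finset.sum_congr rfl fun y _ => hterm y, ← Finset.sum_filter, Finset.sum_const, nsmul_eq_mul,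
      mul_one, card_filter_eq_one_eq_weight, hσ]
    push_cast
    ring
  · rw [if_neg hσ]
    refine Finset.sum_eq_zero fun y _ => ?_
    by_cases hy : σ y = 1
    · have hw := weight_update σ y 0
      rw [hy] at hw
      simp only [Fin.val_one, Fin.val_zero, add_zero] at hw
      have hw' : (∑ z, ((Function.update σ y 0 z : Fin 2) : ℕ)) ≠ W := by omega
      simp [hy, hw']
    · simp [hy]

/-- **`S⁺_tot 𝟙_{W+1} = (N − W) · 𝟙_W`** on `N` sites (a configuration of weight `W` has `N − W` up
spins, each of which can be lowered to reach weight `W+1`). Tasaki (2020) §2.4. [folklore] -/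
theorem raiseTot_mulVec_weightInd (W : ℕ) (σ : V → Fin 2) :
    ((∑ x : V, onSite x (spinRaise 1)) *ᵥ
        (fun τ : V → Fin 2 => if (∑ z, (τ z : ℕ)) = W + 1 then (1 : ℂ) else 0)) σ =
      if (∑ z, (σ z : ℕ)) = W then (((Fintype.card V : ℕ) : ℂ) - W) else 0 := by
  rw [raiseTot_mulVec_apply]
  by_cases hσ : (∑ z, (σ z : ℕ)) = W
  · rw [if_pos hσ]
    have hterm : ∀ x : V, (if σ x = 0 then
        (fun τ : V → Fin 2 => if (∑ z, (τ z : ℕ)) = W + 1 then (1 : ℂ) else 0) (Function.update σ x 1)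
        else 0) = if σ x = 0 then (1 : ℂ) else 0 := by
      intro x
      by_cases hx : σ x = 0
      · have hw := weight_update σ x 1
        rw [hx, hσ] at hw
        simp only [Fin.val_zero, add_zero, Fin.val_one] at hw
        simp [hx, hw]
      · simp [hx]
    rw [Finset.sum_congr rfl fun x _ => hterm x, ← Finset.sum_filter, Finset.sum_const, nsmul_eq_mul,
      mul_one]
    have hc := card_filter_eq_zero_eq σ
    rw [hσ] at hc
    have hc' : ((Finset.univ.filter fun x => σ x = 0).card : ℂ) = ((Fintype.card V : ℕ) : ℂ) - W := by
      rw [← hc]; push_cast; ring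
    rw [hc']
  · rw [if_neg hσ]
    refine Finset.sum_eq_zero fun x _ => ?_
    by_cases hx : σ x = 0
    · have hw := weight_update σ x 1
      rw [hx] at hw
      simp only [Fin.val_zero, add_zero, Fin.val_one] at hw
      have hw' : (∑ z, ((Function.update σ x 1 z : Fin 2) : ℕ)) ≠ W + 1 := by omega
      simp [hx, hw']
    · simp [hx]

/-- **`S⁺_tot S⁻_tot 𝟙_W = (W+1)(N−W) · 𝟙_W`**: the weight indicator is an eigenvector of the
condensate operator (it is the `S^z = N/2 − W` member of the top spin multiplet). Tasaki (2020)
§2.4–2.5. [folklore] -/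
theorem condensate_mulVec_weightInd (W : ℕ) :
    ((∑ x : V, onSite x (spinRaise 1)) * (∑ y : V, onSite y (spinLower 1))) *ᵥ
        (fun τ : V → Fin 2 => if (∑ z, (τ z : ℕ)) = W then (1 : ℂ) else 0) =
      (((W : ℂ) + 1) * (((Fintype.card V : ℕ) : ℂ) - W)) •
        (fun τ : V → Fin 2 => if (∑ z, (τ z : ℕ)) = W then (1 : ℂ) else 0) := by
  rw [← mulVec_mulVec]
  have h1 : (∑ y : V, onSite y (spinLower 1)) *ᵥ
      (fun τ : V → Fin 2 => if (∑ z, (τ z : ℕ)) = W then (1 : ℂ) else 0) =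
      ((W : ℂ) + 1) • (fun τ : V → Fin 2 => if (∑ z, (τ z : ℕ)) = W + 1 then (1 : ℂ) else 0) := by
    funext σ
    rw [lowerTot_mulVec_weightInd, Pi.smul_apply, smul_eq_mul]
    split_ifs <;> simp
  rw [h1, mulVec_smul]
  funext σ
  rw [Pi.smul_apply, Pi.smul_apply, smul_eq_mul, smul_eq_mul, raiseTot_mulVec_weightInd]
  split_ifs <;> ring

end Ladder

/-! ### The torus: `P₀𝟙` is the half-filled indicator -/

/-- For even `M` the sector label `|Λ|·1/2 − M²/2` of the half-filled weight is `0`. [bookkeeping] -/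
theorem halfFilled_label (M : ℕ) [NeZero M] (hM : Even M) :
    ((Fintype.card (TorusSite 2 M) * 1 : ℕ) : ℝ) / 2 - ((M ^ 2 / 2 : ℕ) : ℝ) = 0 := by
  obtain ⟨k, rfl⟩ := hM
  have hk : (k + k) ^ 2 / 2 = 2 * k ^ 2 := by
    rw [show (k + k) ^ 2 = 2 * (2 * k ^ 2) by ring, Nat.mul_div_cancel_left _ (by norm_num)]
  rw [show Fintype.card (TorusSite 2 (k + k)) = (k + k) ^ 2 by simp [Fintype.card_pi, ZMod.card], hk]
  push_cast
  ring

/-- Membership in the half-filled sector `spinZSector 1 0` of the even torus is support on the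
configurations of weight `M²/2`. Tasaki (2020) §2.4, eq. (2.4.5). [folklore] -/
theorem mem_halfFilled_iff (M : ℕ) [NeZero M] (hM : Even M)
    (ψ : TensorIndex (TorusSite 2 M) 2 → ℂ) :
    ψ ∈ spinZSector (Λ := TorusSite 2 M) 1 0 ↔ ∀ σ, (∑ z, (σ z : ℕ)) ≠ M ^ 2 / 2 → ψ σ = 0 := by
  have h := LiebMattis.mem_spinZSector_weight_iff (Λ := TorusSite 2 M) 1 (M ^ 2 / 2) ψ
  rw [halfFilled_label M hM] at h
  exact h

/-- **`P₀ 𝟙 = 𝟙_{M²/2}`**: the orthogonal projection of the all-ones vector onto the half-filled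
sector is the half-filled indicator (the sector is spanned by the half-filled basis configurations).
Tasaki (2020) App. A.2. [folklore] -/
theorem sectorProj_mulVec_ones (M : ℕ) [NeZero M] (hM : Even M) :
    sectorProj M *ᵥ (fun _ => (1 : ℂ)) =
      fun σ : TensorIndex (TorusSite 2 M) 2 => if (∑ z, (σ z : ℕ)) = M ^ 2 / 2 then (1 : ℂ) else 0 := by
  set K : Submodule ℂ (TensorIndex (TorusSite 2 M) 2 → ℂ) := spinZSector (Λ := TorusSite 2 M) 1 0
    with hK
  set ind : TensorIndex (TorusSite 2 M) 2 → ℂ :=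
    fun σ => if (∑ z, (σ z : ℕ)) = M ^ 2 / 2 then (1 : ℂ) else 0 with hind
  have hindK : ind ∈ K := by
    rw [hK, mem_halfFilled_iff M hM]
    intro σ hσ
    simp [hind, hσ]
  have hsplit : (fun _ : TensorIndex (TorusSite 2 M) 2 => (1 : ℂ)) = ind + ((fun _ => (1 : ℂ)) - ind) := by
    rw [add_sub_cancel]
  have horth : ∀ w ∈ K, star w ⬝ᵥ ((fun _ : TensorIndex (TorusSite 2 M) 2 => (1 : ℂ)) - ind) = 0 := by
    intro w hw
    rw [hK, mem_halfFilled_iff M hM] at hw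
    rw [dotProduct]
    refine Finset.sum_eq_zero fun σ _ => ?_
    by_cases hσ : (∑ z, (σ z : ℕ)) = M ^ 2 / 2
    · simp [hind, hσ]
    · rw [Pi.star_apply, hw σ hσ, star_zero, zero_mul]
  rw [hsplit, mulVec_add, sectorProj_eq, projMatrix_map_mulVec_of_mem K hindK,
    projMatrix_map_mulVec_eq_zero_of_orthogonal K horth, add_zero]

/-- Entries of `P₀𝟙`. [folklore] -/
theorem sectorProj_mulVec_ones_apply (M : ℕ) [NeZero M] (hM : Even M)
    (σ : TensorIndex (TorusSite 2 M) 2) :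
    (sectorProj M *ᵥ (fun _ => (1 : ℂ))) σ = if (∑ z, (σ z : ℕ)) = M ^ 2 / 2 then (1 : ℂ) else 0 := by
  rw [sectorProj_mulVec_ones M hM]

/-- There is a half-filled configuration (any `M²/2`-subset of the sites). [folklore] -/
theorem exists_halfFilled (M : ℕ) [NeZero M] :
    ∃ σ : TensorIndex (TorusSite 2 M) 2, (∑ z, (σ z : ℕ)) = M ^ 2 / 2 := by
  obtain ⟨T, -, hT⟩ := Finset.exists_subset_card_eq (s := (Finset.univ : Finset (TorusSite 2 M)))
    (n := M ^ 2 / 2) (by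
      rw [Finset.card_univ, show Fintype.card (TorusSite 2 M) = M ^ 2 by simp [Fintype.card_pi, ZMod.card]]
      exact Nat.div_le_self _ _)
  refine ⟨fun z => if z ∈ T then 1 else 0, ?_⟩
  have h : ∀ z : TorusSite 2 M, (((if z ∈ T then 1 else 0 : Fin 2) : ℕ)) = if z ∈ T then 1 else 0 := by
    intro z
    split_ifs <;> rfl
  simp only [h]
  rw [Finset.sum_ite_mem, Finset.univ_inter, Finset.sum_const, smul_eq_mul, mul_one, hT]

/-- `P₀𝟙 ≠ 0`. [folklore] -/
theorem sectorProj_mulVec_ones_ne_zero (M : ℕ) [NeZero M] (hM : Even M) :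
    sectorProj M *ᵥ (fun _ => (1 : ℂ)) ≠ 0 := by
  obtain ⟨σ, hσ⟩ := exists_halfFilled M
  intro h
  have h1 := congrFun h σ
  rw [sectorProj_mulVec_ones_apply M hM, if_pos hσ, Pi.zero_apply] at h1
  exact one_ne_zero h1

/-- `⟨P₀𝟙, P₀𝟙⟩` is real and positive. [folklore] -/
theorem star_dotProduct_sectorProj_ones_pos (M : ℕ) [NeZero M] (hM : Even M) :
    0 < (star (sectorProj M *ᵥ (fun _ => (1 : ℂ))) ⬝ᵥ (sectorProj M *ᵥ (fun _ => (1 : ℂ)))).re :=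
  (Complex.pos_iff.mp (dotProduct_star_self_pos_iff.mpr (sectorProj_mulVec_ones_ne_zero M hM))).1

/-- **`S⁺_tot S⁻_tot (P₀𝟙) = (M²/2)(M²/2+1) · P₀𝟙`** (even `M`): the polarised boundary vector of
the slab is an eigenvector of the condensate operator with the top eigenvalue `S(S+1)`, `S = M²/2`.
Tasaki (2020) §2.4–2.5. [folklore] -/
theorem condensateOp_mulVec_sectorProj_ones (M : ℕ) [NeZero M] (hM : Even M) :
    condensateOp M *ᵥ (sectorProj M *ᵥ (fun _ => (1 : ℂ))) =
      ((((M ^ 2 / 2 : ℕ) : ℝ) * (((M ^ 2 / 2 : ℕ) : ℝ) + 1) : ℝ) : ℂ) •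
        (sectorProj M *ᵥ (fun _ => (1 : ℂ))) := by
  rw [sectorProj_mulVec_ones M hM, condensateOp_eq, condensate_mulVec_weightInd,
    show Fintype.card (TorusSite 2 M) = M ^ 2 by simp [Fintype.card_pi, ZMod.card]]
  congr 1
  obtain ⟨k, rfl⟩ := hM
  have hk : (k + k) ^ 2 / 2 = 2 * k ^ 2 := by
    rw [show (k + k) ^ 2 = 2 * (2 * k ^ 2) by ring, Nat.mul_div_cancel_left _ (by norm_num)]
  rw [hk]
  push_cast
  ring

/-- **Perron bound for the condensate operator on the half-filled sector**: for every `x`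
supported on the half-filled configurations, `Re⟨x, S⁺_tot S⁻_tot x⟩ ≤ (M²/2)(M²/2+1) · ⟨x, x⟩`
(the AM–GM tangent bound `re_star_dotProduct_mulVec_le_sum_norm_sq_mul_field` at the positive
eigenvector `𝟙_{M²/2}`). Tasaki (2020) §2.5. [folklore] -/
theorem re_form_condensateOp_le (M : ℕ) [NeZero M] (hM : Even M)
    (x : TensorIndex (TorusSite 2 M) 2 → ℂ) (hx : ∀ σ, x σ ≠ 0 → (∑ z, (σ z : ℕ)) = M ^ 2 / 2) :
    (star x ⬝ᵥ (condensateOp M *ᵥ x)).re ≤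
      (((M ^ 2 / 2 : ℕ) : ℝ) * (((M ^ 2 / 2 : ℕ) : ℝ) + 1)) * (star x ⬝ᵥ x).re := by
  set a : ℝ := ((M ^ 2 / 2 : ℕ) : ℝ) * (((M ^ 2 / 2 : ℕ) : ℝ) + 1) with ha
  set ψ : TensorIndex (TorusSite 2 M) 2 → ℝ :=
    fun σ => if (∑ z, (σ z : ℕ)) = M ^ 2 / 2 then 1 else 0 with hψ
  have hψnn : ∀ σ, 0 ≤ ψ σ := fun σ => by simp only [hψ]; split_ifs <;> norm_num
  have hψsupp : ∀ σ, x σ ≠ 0 → 0 < ψ σ := fun σ h => by simp only [hψ, if_pos (hx σ h)]; norm_num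
  have hcast : (fun σ => ((ψ σ : ℝ) : ℂ)) = sectorProj M *ᵥ (fun _ => (1 : ℂ)) := by
    rw [sectorProj_mulVec_ones M hM]
    funext σ
    simp only [hψ]
    split_ifs <;> simp
  have h := re_star_dotProduct_mulVec_le_sum_norm_sq_mul_field (condensateOp M)
    (fun i j => by rw [condensateOp_eq]; exact condensate_apply_nonneg 1 i j)
    (fun i j => by rw [condensateOp_eq]; exact condensate_apply_symm 1 i j) ψ x hψnn hψsupp
  rw [hcast, condensateOp_mulVec_sectorProj_ones M hM, ← hcast] at h
  refine h.trans (le_of_eq ?_)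
  -- the field is the constant `a` on the support of `x`
  have hterm : ∀ σ, ‖x σ‖ ^ 2 * ((((a : ℂ) • fun σ => ((ψ σ : ℝ) : ℂ)) σ).re / ψ σ) = a * ‖x σ‖ ^ 2 := by
    intro σ
    by_cases hσ : x σ = 0
    · simp [hσ]
    · have hw := hx σ hσ
      simp only [Pi.smul_apply, smul_eq_mul, hψ, if_pos hw]
      rw [Complex.ofReal_one, mul_one, Complex.ofReal_re, div_one, mul_comm]
  rw [Finset.sum_congr rfl fun σ _ => hterm σ, ← Finset.mul_sum]
  congr 1
  rw [dotProduct, Complex.re_sum]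
  refine Finset.sum_congr rfl fun σ _ => ?_
  rw [Pi.star_apply, Complex.star_def, ← Complex.normSq_eq_conj_mul_self, Complex.normSq_eq_norm_sq]
  norm_cast

end Summit.HubbardSuperconductivity.HubbardSuperconductivity.Theorems.AnisotropyChord

end
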